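import Literature.Analysis.FluidPDE.TsaiHeadPressureIdentity
import Literature.Analysis.FluidPDE.SwirlTransportProofs
import HarnessLib

/-!
# Pineau–Vicol 2026, §4 and §7.3: the equation satisfied by the Bernoulli function

Analysis/FluidPDE proofs file (no definitions, no named facts), second companion of the named
facts `pineauVicol2026_rss_liouville` (Thm. 1.4) and `pineauVicol2026_rdss_liouville` (Thm. 1.7)
of `PineauVicolRSS.lean` (B. Pineau, V. Vicol, arXiv:2607.09619v2, 2026; printed page numbers),
after `PineauVicolRSSProofs.lean` (Step 1, (1.14b), Lemma 4.1, Lemma 7.2, the §7.5 endgame).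
It lands the structural identity at the heart of the paper's weighted-`L²` method:

* **(4.3) (p. 11) and (7.7) (p. 25)**, for the head pressure ("Bernoulli function")
  `Π = P + ½|U|² + ½ y·U` (4.1) and the non-normal operator `L = −Δ + (U + y/2)·∇` (4.2):
  if `(U, P)` solve the rotated profile system (1.8) / (1.14a) then
  `LΠ + |Ω|² = αE − (U + ½y)·∂_sU`, with the error term (4.4)
  `E = ½(y₁U₂ − y₂U₁) + (U + ½y)·(y₁∂₂U − y₂∂₁U)` ("for general `α ∈ ℝ`, if `(U, P)` solves
  (1.8) then `LΠ + |Ω|² = … = −α(U + ½y)·(JU − (Jy·∇)U) = αE`", p. 11; "by repeating the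
  computation in (4.3) we obtain that `LΠ + |Ω|² = αE − (U + ½y)·∂_sU`", (7.7), p. 25).

The tree already proves the unforced case `α = 0`, `∂_sU = 0` — Tsai's (1.7) = NRŠ's (1.5),
`IsLerayProfile.driftOp_headPressure` (`TsaiHeadPressureIdentity.lean`), in coordinates on
`EuclideanSpace ℝ ι` with `Π = headPressure a U P`, `−L = driftOp ν a U`. Here the same
computation is run for a FORCED Leray profile system `−νΔU + aU + a(y·∇)U + (U·∇)U + ∇P = −F`
(`driftOp_headPressure_forced`: `νΔΠ − DΠ[U + ay] = ν(|∇U|² − tr((∇U)²)) + ⟪U + ay, F⟫`), the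
bookkeeping being reduced to the tree's `driftOp_headPressure_algebra` with `∇P + F` in place
of `∇P` (`driftOp_headPressure_algebra_forced`). The pressure Poisson equation is taken in the
trace form `ΔP = −tr((∇U)²)` as a hypothesis (for Pineau–Vicol `P = RᵢRⱼ(UⁱUʲ)`, Lemmas 2.1 /
7.1, and `∇·F = 0`, p. 9: "`∇·(JU − (Jy·∇)U) = 0` and `∇·(U + (y·∇U)) = 0` when `∇·U = 0`").
On `ℝ³`, `|curl U|² = |∇U|² − tr((∇U)²)` (`norm_curl_sq_eq_sum`) and the rotation forcing
`F = ∂_sU + α(JU − (Jy·∇)U)`, `J = rotGen`, give (7.7) verbatim (`bernoulli_identity_rdss`;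
`∂_sU = 0` is (4.3)), the `α`-term being `−αE` by the skewness of `J` (`inner_rotGen_left`).

Not here: the multiplication of (7.8) by the adjoint weight `w̄` and the space–time integration
(5.4) / (7.10) (needs the weight of Prop. 5.1 and whole-space integrations by parts), nor the
passage `L → L̄` of (7.8) (a rewriting, `L − L̄ = Ũ·∇`).

## References

* B. Pineau, V. Vicol, arXiv:2607.09619 (2026): §4 (4.1)–(4.4) (p. 11), Lemma 4.1 (p. 12),
  §7.3 (7.7)–(7.8) (p. 25), §1.4 (1.14a) (p. 7), proof of Lemma 2.1 (p. 9). [PineauVicol2026]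
* T.-P. Tsai, ARMA 143 (1998), (1.7) (the case `α = 0`, as proved in
  `TsaiHeadPressureIdentity.lean`). [Tsai1998]
-/

noncomputable section

open Set InnerProductSpace
open scoped RealInnerProductSpace Laplacian ContDiff BigOperators

namespace Literature.Analysis.FluidPDE

namespace PineauVicol2026

/-! ### The equation satisfied by the Bernoulli function: (4.3) and (7.7) -/

section Forced

variable {ι : Type*} [Fintype ι] [DecidableEq ι]
variable {ν a : ℝ} {U F : EuclideanSpace ℝ ι → EuclideanSpace ℝ ι} {P : EuclideanSpace ℝ ι → ℝ}

omit [DecidableEq ι] in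
/-- **The finite-sum bookkeeping behind (4.3)/(7.7), forced form of Tsai's (1.7).** As
`driftOp_headPressure_algebra`, but with the pressure gradient solved from a FORCED profile
system, `p₁ₗ = ν∑ₖ ddₖₖₗ − a uₗ − ∑ⱼ wⱼ dⱼₗ − fₗ`: the forcing contributes `+ ∑ₗ wₗ fₗ`
(obtained from the unforced bookkeeping with `p₁ + f` in place of `p₁`). [folklore] -/
theorem driftOp_headPressure_algebra_forced (d : ι → ι → ℝ) (dd : ι → ι → ι → ℝ)
    (w u p₁ p₂ f : ι → ℝ) (ν a : ℝ) (hPP : ∑ l, p₂ l = -∑ l, ∑ j, d l j * d j l)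
    (hdP : ∀ l, p₁ l = ν * ∑ k, dd k k l - a * u l - ∑ j, w j * d j l - f l)
    (hdiv : ∑ l, d l l = 0) :
    ν * ∑ l, (∑ i, d l i ^ 2 + ∑ i, w i * dd l l i + p₂ l + 2 * a * d l l) -
        ∑ l, w l * (∑ i, w i * d l i + p₁ l + a * u l) =
      ν * (∑ l, ∑ i, d l i ^ 2 - ∑ l, ∑ i, d l i * d i l) + ∑ l, w l * f l := by
  have h := driftOp_headPressure_algebra d dd w u (fun l => p₁ l + f l) p₂ ν a hPP
    (fun l => by rw [hdP l]; ring) hdiv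
  have e : ∑ l, w l * (∑ i, w i * d l i + (p₁ l + f l) + a * u l) =
      ∑ l, w l * (∑ i, w i * d l i + p₁ l + a * u l) + ∑ l, w l * f l := by
    rw [← Finset.sum_add_distrib]
    exact Finset.sum_congr rfl fun l _ => by ring
  rw [e] at h
  linarith

/-- **A forced Leray profile system in coordinates**: if
`−νΔU + aU + a(y·∇)U + (U·∇)U + ∇P = −F` pointwise, then for every `i`,
`−ν ∑ⱼ ∂ⱼ∂ⱼUᵢ + aUᵢ + a ∑ⱼ yⱼ ∂ⱼUᵢ + ∑ⱼ Uⱼ ∂ⱼUᵢ + ∂ᵢP = −Fᵢ` (Pineau–Vicol's (1.14a) is the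
case `ν = 1`, `a = ½`, `F = ∂_sU + α(JU − (Jy·∇)U)`). [cite: PineauVicol2026, (1.14a) (p. 7)] -/
theorem forcedProfile_comp (hU : ContDiff ℝ 2 U)
    (heq : ∀ y, -(ν • (Δ U) y) + a • U y + a • fderiv ℝ U y y + convect U U y + gradient P y =
      -F y)
    (y : EuclideanSpace ℝ ι) (i : ι) :
    -(ν * ∑ j, pderiv j (pderiv j fun z => U z i) y) + a * U y i +
      a * ∑ j, y j * pderiv j (fun z => U z i) y + ∑ j, U y j * pderiv j (fun z => U z i) y +
      pderiv i P y = -F y i := by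
  have hm := congrArg (fun w : EuclideanSpace ℝ ι => w i) (heq y)
  have hdiff : DifferentiableAt ℝ U y := (hU.differentiable (by simp)) y
  simp only [PiLp.add_apply, PiLp.neg_apply, PiLp.smul_apply, smul_eq_mul] at hm
  rw [laplacian_apply_comp hU, euclidean_fderiv_apply_comp hdiff,
    fderiv_apply_eq_sum_mul_pderiv, convect_apply_comp hdiff, gradient_apply_comp] at hm
  exact hm

/-- The pressure gradient of a forced Leray profile, solved from the system:
`∂ᵢP = ν ∑ⱼ ∂ⱼ∂ⱼUᵢ − aUᵢ − ∑ⱼ (Uⱼ + a yⱼ) ∂ⱼUᵢ − Fᵢ`. [cite: PineauVicol2026, (1.14a) (p. 7)] -/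
theorem pderiv_pressure_eq_forced (hU : ContDiff ℝ 2 U)
    (heq : ∀ y, -(ν • (Δ U) y) + a • U y + a • fderiv ℝ U y y + convect U U y + gradient P y =
      -F y)
    (i : ι) (y : EuclideanSpace ℝ ι) :
    pderiv i P y = ν * ∑ j, pderiv j (pderiv j fun z => U z i) y - a * U y i -
      ∑ j, (U y j + a * y j) * pderiv j (fun z => U z i) y - F y i := by
  have h1 := forcedProfile_comp hU heq y i
  have e : ∑ j, (U y j + a * y j) * pderiv j (fun z => U z i) y =
      ∑ j, U y j * pderiv j (fun z => U z i) y + a * ∑ j, y j * pderiv j (fun z => U z i) y := by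
    simp only [add_mul, Finset.sum_add_distrib, Finset.mul_sum, mul_assoc]
  rw [e]
  linarith

omit [DecidableEq ι] in
/-- The head pressure `Π = ½|U|² + P + a y·U` of smooth `U`, `P` is smooth. [folklore] -/
theorem contDiff_headPressure (hU : ContDiff ℝ ∞ U) (hP : ContDiff ℝ ∞ P) (a : ℝ) :
    ContDiff ℝ ∞ (headPressure a U P) := by
  classical
  have hUc : ∀ i, ContDiff ℝ ∞ (fun z : EuclideanSpace ℝ ι => U z i) := fun i =>
    contDiff_comp_euclidean hU i
  rw [headPressure_eq_sum]
  exact ((contDiff_const.mul (ContDiff.sum fun i _ => (hUc i).pow 2)).add hP).add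
    (contDiff_const.mul (ContDiff.sum fun i _ => (contDiff_euclideanCoord i).mul (hUc i)))

/-- **Pineau–Vicol's Bernoulli identity, forced gradient form** ((4.3), p. 11, and (7.7),
p. 25, as one statement): let `U`, `P` be smooth with `div U = 0`, let the FORCED Leray profile
system `−νΔU + aU + a(y·∇)U + (U·∇)U + ∇P = −F` hold pointwise, and let the pressure satisfy
the Poisson equation in trace form, `ΔP = −∑ₗⱼ ∂ₗUⱼ ∂ⱼUₗ` (`= −tr((∇U)²)`; for Pineau–Vicol
`P = RᵢRⱼ(UⁱUʲ)`, Lemma 2.1 / 7.1). Then the head pressure `Π = ½|U|² + P + a y·U` obeys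
`ν ΔΠ − DΠ[U + a y] = ν (|∇U|² − tr((∇U)²)) + ⟪U + a y, F⟫`; with `ν = 1`, `a = ½` and
`−L = Δ − (U + y/2)·∇` this is `LΠ + |Ω|² = −(U + y/2)·F`, i.e. (4.3) for
`F = α(JU − (Jy·∇)U)` and (7.7) for `F = ∂_sU + α(JU − (Jy·∇)U)`. The computation is the
printed one: the equation-free formulas for `∂ₗΠ`, `∂ₗ∂ₗΠ` (`pderiv_headPressure`,
`pderiv_pderiv_headPressure`), the pressure gradient from the system and the bookkeeping
`driftOp_headPressure_algebra_forced`. [cite: PineauVicol2026, (4.3) (p. 11) and (7.7) (p. 25)] -/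
theorem driftOp_headPressure_forced (hU : ContDiff ℝ ∞ U) (hP : ContDiff ℝ ∞ P)
    (heq : ∀ y, -(ν • (Δ U) y) + a • U y + a • fderiv ℝ U y y + convect U U y + gradient P y =
      -F y)
    (hdiv : VectorCalculus.IsDivFree U)
    (hΔP : ∀ y, ∑ l, pderiv l (pderiv l P) y =
      -∑ l, ∑ j, pderiv l (fun z => U z j) y * pderiv j (fun z => U z l) y)
    (y : EuclideanSpace ℝ ι) :
    driftOp ν a U (headPressure a U P) y =
      ν * (∑ l, ∑ i, pderiv l (fun z => U z i) y ^ 2 -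
        ∑ l, ∑ i, pderiv l (fun z => U z i) y * pderiv i (fun z => U z l) y) +
      ⟪U y + a • y, F y⟫ := by
  have hHead : ContDiff ℝ ∞ (headPressure a U P) := contDiff_headPressure hU hP a
  have hU2 : ContDiff ℝ 2 U := hU.of_le (WithTop.coe_le_coe.2 le_top)
  rw [driftOp, laplacian_eq_sum_pderiv_pderiv' (hHead.of_le (WithTop.coe_le_coe.2 le_top)) y,
    fderiv_apply_eq_sum_mul_pderiv]
  simp only [PiLp.add_apply, PiLp.smul_apply, smul_eq_mul]
  rw [Finset.sum_congr rfl fun l _ => congrFun (pderiv_pderiv_headPressure hU hP a l) y,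
    Finset.sum_congr rfl fun l _ =>
      congrArg (fun r => (U y l + a * y l) * r) (congrFun (pderiv_headPressure hU hP a l) y)]
  beta_reduce
  have hinner : ⟪U y + a • y, F y⟫ = ∑ l, (U y l + a * y l) * F y l := by
    rw [euclidean_inner_eq_sum_mul]
    simp only [PiLp.add_apply, PiLp.smul_apply, smul_eq_mul]
  rw [hinner]
  exact driftOp_headPressure_algebra_forced (fun l i => pderiv l (fun z => U z i) y)
    (fun l k i => pderiv l (pderiv k fun z => U z i) y) (fun i => U y i + a * y i) (fun i => U y i)
    (fun l => pderiv l P y) (fun l => pderiv l (pderiv l P) y) (fun l => F y l) ν a (hΔP y)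
    (fun l => pderiv_pressure_eq_forced hU2 heq l y)
    (hdiv.sum_pderiv_comp_eq_zero (hU.differentiable (by simp)) y)

end Forced

/-! ### Specialisation to `ℝ³`: `|Ω|²`, the rotation forcing, (7.7) as printed -/

/-- On `ℝ³`, `|curl U(y)|² = |∇U(y)|² − tr((∇U(y))²)` in coordinates:
`‖curl U y‖² = ∑ₗᵢ (∂ₗUᵢ)² − ∑ₗᵢ ∂ₗUᵢ ∂ᵢUₗ` (the identity `|Ω|² = |∇U|² − tr((∇U)²)` used on
pp. 11 and 31 of Pineau–Vicol). [folklore] -/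
theorem norm_curl_sq_eq_sum {U : EuclideanSpace ℝ (Fin 3) → EuclideanSpace ℝ (Fin 3)}
    {y : EuclideanSpace ℝ (Fin 3)} (hU : DifferentiableAt ℝ U y) :
    ‖curl U y‖ ^ 2 = ∑ l, ∑ i, pderiv l (fun z => U z i) y ^ 2 -
      ∑ l, ∑ i, pderiv l (fun z => U z i) y * pderiv i (fun z => U z l) y := by
  have hD : ∀ j i : Fin 3, fderiv ℝ U y (EuclideanSpace.single j 1) i =
      pderiv j (fun z => U z i) y := fun j i => by
    rw [pderiv_apply, euclidean_fderiv_apply_comp hU]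
  rw [EuclideanSpace.real_norm_sq_eq]
  simp only [curl, Fin.sum_univ_three, hD]
  simp
  ring

/-- **(7.7) as printed, on `ℝ³`.** Let `U(·)` (a time slice of the profile), `P(·)` be smooth
with `∇·U = 0`, let `U_s(·)` denote `∂_sU(·, s)` on that slice, and let the rotated
time-dependent profile system (1.14a) hold pointwise,
`U_s + α(JU − (Jy·∇)U) + ½U + ½(y·∇)U − ΔU + (U·∇)U + ∇P = 0` with `J = rotGen`, together
with the pressure Poisson equation `ΔP = −tr((∇U)²)`. Then, with `Π = P + ½|U|² + ½ y·U`,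
`L = −Δ + (U + y/2)·∇` (so `−LΠ = driftOp 1 ½ U Π`), `Ω = curl U` and the error term (4.4)
`E = ½⟪Jy, U⟫ + ⟪U + ½y, DU(Jy)⟫`:
`LΠ + |Ω|² = αE − (U + ½y)·U_s` ("the resulting identity acquires exactly one new term when
compared to the time-independent setting"; `U_s = 0` is (4.3)).
[cite: PineauVicol2026, (7.7) (p. 25) and (4.3)–(4.4) (p. 11)] -/
theorem bernoulli_identity_rdss {U Us : EuclideanSpace ℝ (Fin 3) → EuclideanSpace ℝ (Fin 3)}
    {P : EuclideanSpace ℝ (Fin 3) → ℝ} {α : ℝ} (hU : ContDiff ℝ ∞ U) (hP : ContDiff ℝ ∞ P)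
    (heq : ∀ y, Us y + α • (rotGen (U y) - fderiv ℝ U y (rotGen y)) + (1 / 2 : ℝ) • U y +
      (1 / 2 : ℝ) • fderiv ℝ U y y - (Δ U) y + convect U U y + gradient P y = 0)
    (hdiv : VectorCalculus.IsDivFree U)
    (hΔP : ∀ y, ∑ l, pderiv l (pderiv l P) y =
      -∑ l, ∑ j, pderiv l (fun z => U z j) y * pderiv j (fun z => U z l) y)
    (y : EuclideanSpace ℝ (Fin 3)) :
    -driftOp 1 (1 / 2) U (headPressure (1 / 2) U P) y + ‖curl U y‖ ^ 2 =
      α * ((1 / 2 : ℝ) * ⟪rotGen y, U y⟫ + ⟪U y + (1 / 2 : ℝ) • y, fderiv ℝ U y (rotGen y)⟫) -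
        ⟪U y + (1 / 2 : ℝ) • y, Us y⟫ := by
  -- the system in forced form, `F = U_s + α(JU − DU(Jy))`
  have heq' : ∀ z, -((1 : ℝ) • (Δ U) z) + (1 / 2 : ℝ) • U z + (1 / 2 : ℝ) • fderiv ℝ U z z +
      convect U U z + gradient P z = -(Us z + α • (rotGen (U z) - fderiv ℝ U z (rotGen z))) := by
    intro z
    have h := heq z
    rw [one_smul]
    rw [← sub_eq_zero]
    rw [← h]
    abel
  rw [driftOp_headPressure_forced hU hP heq' hdiv hΔP y,
    norm_curl_sq_eq_sum ((hU.differentiable (by simp)) y), inner_add_right, inner_smul_right,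
    inner_sub_right, inner_add_left, inner_add_left, real_inner_smul_left, real_inner_smul_left,
    real_inner_comm (rotGen (U y)) (U y), real_inner_comm (rotGen (U y)) y, inner_rotGen_left,
    inner_rotGen_left, inner_rotGen_left]
  ring

end PineauVicol2026

end Literature.Analysis.FluidPDE

end
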